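import Literature.AlgebraicGeometry.Resolution.EtaleChartInField
import Literature.AlgebraicGeometry.Resolution.DecompletionEtalePair
import Mathlib.Algebra.Polynomial.Taylor
import Mathlib.RingTheory.Valuation.ValuationSubring
import HarnessLib

/-!
# The Hensel chart of a root, realized inside a valued field

Topic: `Literature/AlgebraicGeometry/Resolution` (valued function fields; étale charts of models).
Groundwork for the algebraization step of M. Temkin, *Inseparable local uniformization*,
J. Algebra 373 (2013) = arXiv:0804.1554v3, Thm. 3.3.1 (tree: `Temkin2013RelativeCurveSmoothFibre`):
the `K`-side half of the common smooth roof is an explicit ÉTALE algebra over (a localization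
`R = N″` of) the normalized `K`-rational model in which the minimal polynomial `P` of a primitive
constant `y₀ ∈ m` acquires its root — the finite-level form of "`m ⊂ L₁^h`" (the constants lie
in the henselization; Temkin, proof of Thm. 3.3.1, Step 2, and proof of Lemma 3.3.2: "by
Hensel's lemma"). Given an approximation `y ∈ R` of the root `y₀` with `P(y) = P′(y)² β`,
`β ∈ R` (divisibility, arranged by refining the model) and `|y₀ − y| < |P′(y)|` (Newton's
condition at the valuation of the point), the zoomed polynomial
`p̃(Z) = P(y + P′(y) Z)/P′(y)² = β + Z + Z² H(Z) ∈ R[Z]` has the root `z₀ = (y₀ − y)/P′(y)` with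
`p̃′(z₀) = P′(y₀)/P′(y) ≠ 0`; the standard étale algebra `(R[Z]/p̃)[1/p̃′]`
(`EtalePair.ofDerivative`, `DecompletionEtalePair.lean`) maps to `L` by `Z ↦ z₀`, and after the
sheet selection of `EtaleChartInField.lean` (`s₀ ↦ 1`) it becomes a SUBALGEBRA `T ⊆ L`:

* `zoomPoly P y β` and its identities `C (P′(y)²) · p̃ = (taylor y P)(P′(y) Z)`,
  `aeval`-versions for `p̃` and `p̃′` — PROVED;
* `exists_henselChart` — **the Hensel chart in the field**: an `R`-subalgebra `T ⊆ L`, ÉTALE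
  over `R`, with `y₀ ∈ T`, generated over `R` by `z₀` and `u = p̃′(z₀)⁻¹`
  (`T = R[z₀, u]`), `u` lying in every subfield containing `R` and `y₀`, and `T ⊆ V`,
  `|u|_V = 1` for every valuation ring `V ⊇ R` of `L` with `|y₀ − y|_V < |P′(y)|_V` — PROVED.

All statements are [folklore]; `zoomPoly` is an explicit polynomial (a definition with body), no
named facts.

## Sources

* M. Temkin, arXiv:0804.1554v3, proof of Thm. 3.3.1 (Steps 2–3, p. 45) and of Lemma 3.3.2
  (pp. 45–46) (the uses); The Stacks Project, Tag 00UE-type standard étale algebras, through the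
  tree (`EtalePair`).
-/

noncomputable section

open Polynomial

open scoped Polynomial.Bivariate

namespace Literature.AlgebraicGeometry.Resolution

universe u

/-! ### The zoomed polynomial `p̃(Z) = P(y + P′(y) Z) / P′(y)²` -/

section Zoom

variable {R : Type u} [CommRing R]

/-- The zoomed Hensel polynomial: for `P ∈ R[X]`, `y, β ∈ R` (meant to satisfy
`P(y) = P′(y)² β`), `p̃(Z) = β + Z + Z² · H(P′(y) Z)` where `taylor y P = P(y) + P′(y) Z + Z² H(Z)`;
then `P′(y)² p̃(Z) = P(y + P′(y) Z)`. [folklore] -/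
def zoomPoly (P : R[X]) (y β : R) : R[X] :=
  C β + X + X ^ 2 * ((taylor y P).divX.divX.comp (C ((derivative P).eval y) * X))

/-- `taylor y P = P(y) + P′(y)·X + X²·H`. [folklore] -/
theorem taylor_eq_add_add (P : R[X]) (y : R) :
    taylor y P = C (P.eval y) + C ((derivative P).eval y) * X + X ^ 2 * (taylor y P).divX.divX := by
  have h1 := X_mul_divX_add (taylor y P)
  have h2 := X_mul_divX_add (taylor y P).divX
  rw [taylor_coeff_zero] at h1
  rw [coeff_divX, zero_add, taylor_coeff_one] at h2
  calc taylor y P = X * (taylor y P).divX + C (P.eval y) := h1.symm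
    _ = X * (X * (taylor y P).divX.divX + C ((derivative P).eval y)) + C (P.eval y) := by rw [h2]
    _ = _ := by ring

/-- **The zoom identity**: `P′(y)² · p̃ = (taylor y P) ∘ (P′(y) Z)` when `P(y) = P′(y)² β`.
[folklore] -/
theorem C_mul_zoomPoly (P : R[X]) (y β : R) (hP : P.eval y = (derivative P).eval y ^ 2 * β) :
    C ((derivative P).eval y ^ 2) * zoomPoly P y β =
      (taylor y P).comp (C ((derivative P).eval y) * X) := by
  set a := (derivative P).eval y with ha
  conv_rhs => rw [taylor_eq_add_add P y, hP]
  rw [zoomPoly, add_comp, add_comp, mul_comp, mul_comp, C_comp, C_comp, X_comp, pow_comp, X_comp,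
    ← ha, C_mul, C_pow]
  ring

variable {L : Type u} [Field L] [Algebra R L]

/-- Evaluation of `taylor y P` in an algebra: `(taylor y P)(w) = P(w + y)`. [folklore] -/
theorem aeval_taylor (P : R[X]) (y : R) (w : L) :
    aeval w (taylor y P) = aeval (w + algebraMap R L y) P := by
  rw [aeval_def, ← eval_map, map_taylor, taylor_eval, aeval_def, eval_map, eval₂_eq_eval_map,
    eval_map]

/-- `P′(y)² · p̃(z) = P(y + P′(y) z)` in any `R`-algebra. [folklore] -/
theorem aeval_zoomPoly (P : R[X]) (y β : R) (hP : P.eval y = (derivative P).eval y ^ 2 * β)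
    (z : L) :
    algebraMap R L ((derivative P).eval y) ^ 2 * aeval z (zoomPoly P y β) =
      aeval (algebraMap R L y + algebraMap R L ((derivative P).eval y) * z) P := by
  have h := congrArg (aeval z) (C_mul_zoomPoly P y β hP)
  rw [map_mul, aeval_C, map_pow] at h
  rw [h, aeval_comp, map_mul, aeval_C, aeval_X, aeval_taylor, add_comm]

/-- `P′(y)² · p̃′(z) = P′(y) · P′(y + P′(y) z)` in any `R`-algebra. [folklore] -/
theorem aeval_derivative_zoomPoly (P : R[X]) (y β : R)
    (hP : P.eval y = (derivative P).eval y ^ 2 * β) (z : L) :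
    algebraMap R L ((derivative P).eval y) ^ 2 * aeval z (derivative (zoomPoly P y β)) =
      algebraMap R L ((derivative P).eval y) *
        aeval (algebraMap R L y + algebraMap R L ((derivative P).eval y) * z) (derivative P) := by
  have h := congrArg (fun q => aeval z (derivative q)) (C_mul_zoomPoly P y β hP)
  rw [derivative_mul, derivative_C, zero_mul, zero_add, map_mul, aeval_C, map_pow,
    derivative_comp, derivative_mul, derivative_C, zero_mul, zero_add, derivative_X, mul_one] at h
  rw [h, map_mul, aeval_C, aeval_comp, map_mul, aeval_C, aeval_X]
  -- `(taylor y P)′ = taylor y P′`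
  have ht : derivative (taylor y P) = taylor y (derivative P) := by
    rw [taylor_apply, taylor_apply, derivative_comp, derivative_add, derivative_X, derivative_C,
      add_zero, one_mul]
  rw [ht, aeval_taylor, add_comm]

/-- `p̃′ = 1 + X · G` for an explicit `G ∈ R[X]`. [folklore] -/
theorem derivative_zoomPoly_eq (P : R[X]) (y β : R) :
    ∃ G : R[X], derivative (zoomPoly P y β) = 1 + X * G := by
  refine ⟨C 2 * ((taylor y P).divX.divX.comp (C ((derivative P).eval y) * X)) +
    X * derivative ((taylor y P).divX.divX.comp (C ((derivative P).eval y) * X)), ?_⟩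
  rw [zoomPoly, derivative_add, derivative_add, derivative_C, zero_add, derivative_X, derivative_mul,
    derivative_X_pow]
  simp only [Nat.cast_ofNat, Nat.add_one_sub_one, pow_one, map_ofNat]
  ring

/-- Elements of `R[z]` lie in any subring containing `R` and `z` (as a valuation ring).
[folklore] -/
theorem aeval_mem_valuationSubring_of_mem (V : ValuationSubring L)
    (hRV : ∀ r : R, algebraMap R L r ∈ V) {z : L} (hz : z ∈ V) (q : R[X]) : aeval z q ∈ V := by
  let V' : Subalgebra R L :=
    { V.toSubring with
      algebraMap_mem' := fun r => hRV r }
  have h : Algebra.adjoin R {z} ≤ V' := Algebra.adjoin_le (Set.singleton_subset_iff.mpr hz)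
  exact h (aeval_mem_adjoin_singleton R z)

/-- Elements of `R[z]` lie in any subfield containing `R` and `z`. [folklore] -/
theorem aeval_mem_subfield_of_mem (F : Subfield L)
    (hRF : ∀ r : R, algebraMap R L r ∈ F) {z : L} (hz : z ∈ F) (q : R[X]) : aeval z q ∈ F := by
  let F' : Subalgebra R L :=
    { F.toSubring with
      algebraMap_mem' := fun r => hRF r }
  have h : Algebra.adjoin R {z} ≤ F' := Algebra.adjoin_le (Set.singleton_subset_iff.mpr hz)
  exact h (aeval_mem_adjoin_singleton R z)

/-- Two-variable evaluation lands in the subalgebra generated by the two values. [folklore] -/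
theorem aevalAeval_mem_adjoin (x w : L) (q : R[X][Y]) :
    aevalAeval x w q ∈ Algebra.adjoin R ({x, w} : Set L) := by
  induction q using Polynomial.induction_on with
  | C p =>
    rw [aevalAeval_C]
    exact Algebra.adjoin_mono (Set.singleton_subset_iff.mpr (Set.mem_insert _ _))
      (aeval_mem_adjoin_singleton R x)
  | add p q hp hq =>
    rw [map_add]
    exact add_mem hp hq
  | monomial n p _ =>
    rw [map_mul, map_pow, aevalAeval_C, aevalAeval_Y]
    refine mul_mem ?_ (pow_mem (Algebra.subset_adjoin
      (Set.mem_insert_of_mem _ (Set.mem_singleton w))) _)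
    exact Algebra.adjoin_mono (Set.singleton_subset_iff.mpr (Set.mem_insert _ _))
      (aeval_mem_adjoin_singleton R x)

end Zoom

/-! ### The Hensel chart inside the field -/

section Chart

variable {R L : Type u} [CommRing R] [IsDomain R] [IsIntegrallyClosed R] [Field L] [Algebra R L]

/-- **The Hensel chart (with the explicit unit `u = (p̃′(z₀))⁻¹`, `p̃ = zoomPoly P y β`) of a root, realized in the field.** Let `R` be an integrally closed
domain inside a field `L`, `P ∈ R[X]`, `y, β ∈ R` with `P(y) = P′(y)² β` and `P′(y) ≠ 0`, and
`y₀ ∈ L` a root of `P` with `P′(y₀) ≠ 0`. Put `z₀ = (y₀ − y)/P′(y)`. Then there are an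
`R`-subalgebra `T ⊆ L`, ÉTALE over `R`, and `u ∈ T` with: `y₀ ∈ T`; `T = R[z₀, u]`; `u` lies in
every subfield of `L` containing `R` and `y₀`; and for every valuation ring `V ⊇ R` of `L` with
`|y₀ − y|_V < |P′(y)|_V` one has `T ⊆ V` and `|u|_V = 1` (the point of `V` lies on the chart, on
the sheet of the root `y₀`). (`T` is the standard étale `R`-algebra `(R[Z]/p̃)[1/p̃′]`, cut down to
the sheet of `z₀` and embedded by `Z ↦ z₀`; `u = p̃′(z₀)⁻¹`.) [folklore] -/
theorem exists_henselChart (hR : Function.Injective (algebraMap R L)) (P : R[X]) (y β : R)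
    (hP : P.eval y = (derivative P).eval y ^ 2 * β) (ha : (derivative P).eval y ≠ 0)
    (y₀ : L) (hy₀ : aeval y₀ P = 0) (hy₀' : aeval y₀ (derivative P) ≠ 0) :
    ∃ (T : Subalgebra R L) (u : L), Algebra.Etale R T ∧ y₀ ∈ T ∧ u ∈ T ∧
      T = Algebra.adjoin R
        ({(y₀ - algebraMap R L y) / algebraMap R L ((derivative P).eval y), u} : Set L) ∧
      (∀ F : Subfield L, (∀ r : R, algebraMap R L r ∈ F) → y₀ ∈ F → u ∈ F) ∧
      (∀ V : ValuationSubring L, (∀ r : R, algebraMap R L r ∈ V) →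
        V.valuation (y₀ - algebraMap R L y) < V.valuation (algebraMap R L ((derivative P).eval y)) →
        T.toSubring ≤ V.toSubring ∧ V.valuation u = 1) ∧
      u * aeval ((y₀ - algebraMap R L y) / algebraMap R L ((derivative P).eval y))
        (derivative (zoomPoly P y β)) = 1 := by
  classical
  set a := (derivative P).eval y with ha'
  set aL := algebraMap R L a with haL
  set yL := algebraMap R L y with hyL
  have haL0 : aL ≠ 0 := (map_ne_zero_iff _ hR).mpr ha
  set z₀ : L := (y₀ - yL) / aL with hz₀
  have hyz : yL + aL * z₀ = y₀ := by
    rw [hz₀, mul_div_cancel₀ _ haL0]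
    ring
  set p := zoomPoly P y β with hp
  -- `p̃(z₀) = 0`, `p̃′(z₀) ≠ 0`
  have hpz : aeval z₀ p = 0 := by
    have h := aeval_zoomPoly P y β hP z₀
    rw [hyz, hy₀, mul_eq_zero] at h
    exact h.resolve_left (pow_ne_zero 2 haL0)
  have hpz' : aeval z₀ (derivative p) ≠ 0 := by
    intro h0
    have h := aeval_derivative_zoomPoly P y β hP z₀
    rw [hyz, ← hp, h0, mul_zero] at h
    exact mul_ne_zero haL0 hy₀' h.symm
  -- the étale pair and its map to `L`
  let Pp : EtalePair R := EtalePair.ofDerivative p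
  have hmap : Pp.HasMap z₀ := ⟨hpz, isUnit_iff_ne_zero.mpr hpz'⟩
  let ψ : Pp.Ring →ₐ[R] L := Pp.lift z₀ hmap
  letI : Algebra Pp.Ring L := ψ.toRingHom.toAlgebra
  haveI : IsScalarTower R Pp.Ring L :=
    IsScalarTower.of_algebraMap_eq fun r => (ψ.commutes r).symm
  have hψ : ∀ s, algebraMap Pp.Ring L s = ψ s := fun _ => rfl
  -- `u = p̃′(z₀)⁻¹ = ψ(Y)`
  set u : L := (aeval z₀ (derivative p))⁻¹ with hu
  have hψX : ψ Pp.X = z₀ := Pp.lift_X z₀ hmap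
  have hψg : ψ (Pp.proj (C Pp.g)) = aeval z₀ (derivative p) := by
    change ψ (Pp.proj (C (derivative p))) = _
    rw [EtalePair.lift_proj, aevalAeval_C]
  have hunit : (↑(hmap.2.unit⁻¹) : L) = u := by
    rw [Units.val_inv_eq_inv_val, IsUnit.unit_spec]
    rfl
  have hψY : ψ Pp.invG = u := by
    rw [EtalePair.lift_invG, hunit]
  -- sheet selection and the injective localization
  obtain ⟨s₀, h1, hkill⟩ := exists_eq_one_and_mul_eq_zero_of_etale (R := R) (S := Pp.Ring) (L := L) hR
  let Sₛ := Localization.Away s₀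
  have hs₀ : IsUnit (ψ s₀) := by rw [← hψ, h1]; exact isUnit_one
  let Λ : Sₛ →ₐ[R] L := IsLocalization.Away.liftAlgHom s₀ hs₀
  have hΛinj : Function.Injective Λ := injective_awayLift_of_etale h1 hkill Sₛ
  have hΛalg : ∀ s : Pp.Ring, Λ (algebraMap Pp.Ring Sₛ s) = ψ s := fun s =>
    IsLocalization.Away.lift_eq s₀ hs₀ s
  -- the chart
  let T : Subalgebra R L := Λ.range
  haveI : Algebra.Etale R Sₛ := inferInstance
  have hT : Algebra.Etale R T := Algebra.Etale.of_equiv (AlgEquiv.ofInjective Λ hΛinj)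
  have hz₀T : z₀ ∈ T := (AlgHom.mem_range Λ).mpr ⟨algebraMap Pp.Ring Sₛ Pp.X, by rw [hΛalg, hψX]⟩
  have huT : u ∈ T := (AlgHom.mem_range Λ).mpr ⟨algebraMap Pp.Ring Sₛ Pp.invG, by rw [hΛalg, hψY]⟩
  have hTeq : T = Algebra.adjoin R ({z₀, u} : Set L) := by
    apply le_antisymm
    · intro x hx
      obtain ⟨w, rfl⟩ := (AlgHom.mem_range Λ).mp hx
      obtain ⟨⟨s, y⟩, rfl⟩ := IsLocalization.mk'_surjective (Submonoid.powers s₀) w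
      obtain ⟨n, hn⟩ := (Submonoid.mem_powers_iff (y : Pp.Ring) s₀).mp y.2
      have hw : Λ (IsLocalization.mk' Sₛ s y) = ψ s := by
        have h2 : Λ (IsLocalization.mk' Sₛ s y) *
            Λ (algebraMap Pp.Ring Sₛ (y : Pp.Ring)) = Λ (algebraMap Pp.Ring Sₛ s) := by
          rw [← map_mul, IsLocalization.mk'_spec Sₛ s y]
        rw [hΛalg, hΛalg, ← hn, map_pow, ← hψ s₀, h1, one_pow, mul_one] at h2
        exact h2
      show Λ (IsLocalization.mk' Sₛ s y) ∈ Algebra.adjoin R ({z₀, u} : Set L)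
      rw [hw]
      obtain ⟨q, rfl⟩ := Pp.proj_surjective s
      change Pp.lift z₀ hmap (Pp.proj q) ∈ _
      rw [EtalePair.lift_proj, hunit]
      exact aevalAeval_mem_adjoin z₀ u q
    · refine Algebra.adjoin_le ?_
      rintro x (rfl | rfl)
      · exact hz₀T
      · exact huT
  obtain ⟨G, hG⟩ := derivative_zoomPoly_eq P y β
  refine ⟨T, u, hT, ?_, huT, hTeq, fun F hRF hy₀F => ?_, fun V hRV hV => ?_,
    by rw [hu]; exact inv_mul_cancel₀ hpz'⟩
  · -- `y₀ = y + a z₀ ∈ T`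
    rw [← hyz]
    exact add_mem (T.algebraMap_mem y) (mul_mem (T.algebraMap_mem a) hz₀T)
  · -- `u ∈ F`
    have hz₀F : z₀ ∈ F := F.div_mem (F.sub_mem hy₀F (hRF y)) (hRF a)
    exact F.inv_mem (aeval_mem_subfield_of_mem F hRF hz₀F _)
  · -- the valuation ring of the point
    have hz₀V : V.valuation z₀ < 1 := by
      rw [hz₀, map_div₀, div_lt_one₀ ((Valuation.pos_iff _).mpr haL0)]
      exact hV
    have hz₀V' : z₀ ∈ V := (V.valuation_le_one_iff _).mp hz₀V.le
    have hvu' : V.valuation (aeval z₀ (derivative p)) = 1 := by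
      rw [hG, map_add, map_one, map_mul, aeval_X]
      refine Valuation.map_one_add_of_lt _ ?_
      rw [map_mul]
      calc V.valuation z₀ * V.valuation (aeval z₀ G)
          ≤ V.valuation z₀ * 1 :=
            mul_le_mul' le_rfl ((V.valuation_le_one_iff _).mpr
              (aeval_mem_valuationSubring_of_mem V hRV hz₀V' G))
        _ < 1 := by rw [mul_one]; exact hz₀V
    have hvu : V.valuation u = 1 := by rw [hu, map_inv₀, hvu', inv_one]
    refine ⟨?_, hvu⟩
    have huV : u ∈ V := (V.valuation_le_one_iff _).mp hvu.le
    let V' : Subalgebra R L :=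
      { V.toSubring with
        algebraMap_mem' := fun r => hRV r }
    have hle : Algebra.adjoin R ({z₀, u} : Set L) ≤ V' := by
      refine Algebra.adjoin_le ?_
      rintro x (rfl | rfl)
      · exact hz₀V'
      · exact huV
    intro x hx
    have hx' : x ∈ Algebra.adjoin R ({z₀, u} : Set L) := by rw [← hTeq]; exact hx
    exact hle hx'

end Chart

end Literature.AlgebraicGeometry.Resolution

end
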